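import Mathlib.Data.Matrix.Basis
import Mathlib.LinearAlgebra.Matrix.Trace
import Mathlib.Algebra.Module.BigOperators
import Mathlib.Tactic.Abel
import Mathlib.Tactic.Ring
import HarnessLib

/-!
# `𝔰𝔬(N)` contractions over the antisymmetric matrix units `X_ij = E_ij − E_ji` (gauge-boot, ADDENDUM 27 part M1)

HONEST FRAMING (cell `pub-gaugeboot`, page 1 of every file): the venture produces certified bounds
on lattice expectations at stated coupling, gauge group, dimension and torus size; NOT a mass gap,
NOT a continuum limit, NOT a string tension; NOT Yang–Mills-summit-bearing (barriers
`FixedCouplingUltralocality`, `PerturbativeInvisibility`).  Pure matrix algebra over a commutative ring; nothing about a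
lattice theory is claimed here.

## Content

ADDENDUM 27 of the lane points its one-link Schwinger–Dyson machinery at the tree's NAMED FACT
`Chatterjee2019LargeN.UnsymmetrizedMasterLoopEquation` (S. Chatterjee, CMP 366 (2019), Theorem 8.1: the finite-`N` `SO(N)`
master loop equation at a marked edge).  For `SO(N)` no polarisation is needed: the antisymmetric matrix units
`X_ij = E_ij − E_ji` (`soDir i j`; `X_ii = 0`, `X_ji = −X_ij`) are genuine one-parameter generators, and summing the
Schwinger–Dyson identity in the direction `X_ij` over ALL ordered pairs `(i, j)` realises the completeness relation of
`𝔰𝔬(N)` twice over.  This file is the algebra of that double sum: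

* `sum_soDir_mul_mul_soDir` — **`Σ_ij X_ij A X_ij = 2(Aᵀ − (tr A)·1)`** (the transpose is Chatterjee's TWISTING, the
  trace his SPLITTING);
* `sum_soDir_mul_soDir` — **`Σ_ij X_ij X_ij = −2(N−1)·1`** (the Casimir: the coefficient `(N−1)m` of Theorem 8.1);
* `sum_trace_soDir_mul_mul_trace_soDir_mul` — **`Σ_ij tr(X_ij A)·tr(X_ij B) = 2(tr(A Bᵀ) − tr(A B))`** (MERGERS and,
  with `B` a plaquette, DEFORMATIONS);
* `sum_trace_soDir_sandwich` — `Σ_ij tr(X_ij A X_ij B) = 2(tr(Aᵀ B) − tr A · tr B)`.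

References: S. Chatterjee, *Rigorous solution of strongly coupled SO(N) lattice gauge theory in the large N limit*,
Comm. Math. Phys. 366 (2019) 203–268, §§5–8 (Stein's equation for `SO(N)`); the lane's `LoopEquation.lean`
(`sum_trace_unitDir_sandwich`, the `𝔲(N)`/`𝔰𝔲(N)` analogue).  Everything is `[folklore]`.
-/

namespace Summit.QuantumFields.GaugeBoot

namespace SOMasterLoop

open Matrix

variable {n : Type*} [DecidableEq n] {R : Type*} [CommRing R]

/-- The antisymmetric matrix unit `X_ij = E_ij − E_ji` — for `i ≠ j` a generator of the rotations in the `(i, j)`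
plane; `X_ii = 0`. [folklore] -/
def soDir (i j : n) : Matrix n n R := single i j 1 - single j i 1

/-- Entries of `X_ij`. [folklore] -/
theorem soDir_apply (i j a b : n) :
    (soDir i j : Matrix n n R) a b = (if i = a ∧ j = b then 1 else 0) - (if j = a ∧ i = b then 1 else 0) := by
  simp only [soDir, sub_apply, single_apply]

/-- `X_ii = 0`. [folklore] -/
@[simp] theorem soDir_self (i : n) : (soDir i i : Matrix n n R) = 0 := sub_self _

/-- `X_ji = −X_ij`. [folklore] -/
theorem soDir_swap (i j : n) : (soDir j i : Matrix n n R) = -soDir i j := by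
  unfold soDir; rw [neg_sub]

/-- `X_ij` is antisymmetric: `X_ijᵀ = −X_ij`. [folklore] -/
theorem transpose_soDir (i j : n) : (soDir i j : Matrix n n R)ᵀ = -soDir i j := by
  unfold soDir
  rw [transpose_sub, transpose_single, transpose_single, neg_sub]

variable [Fintype n]

/-- `X_ij` is traceless. [folklore] -/
theorem trace_soDir (i j : n) : ((soDir i j : Matrix n n R)).trace = 0 := by
  unfold soDir
  rw [trace_sub]
  by_cases h : i = j
  · subst h; simp
  · rw [trace_single_eq_of_ne _ _ _ h, trace_single_eq_of_ne _ _ _ (Ne.symm h), sub_zero]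

/-- `Σ_ij E_ij A E_ij = Aᵀ`. [folklore] -/
theorem sum_single_mul_mul_single_same (A : Matrix n n R) :
    ∑ i : n, ∑ j : n, single i j (1 : R) * A * single i j 1 = Aᵀ := by
  simp only [single_mul_mul_single, one_mul, mul_one]
  rw [matrix_eq_sum_single Aᵀ]
  rfl

/-- `Σ_ij E_ij A E_ji = (tr A)·1`. [folklore] -/
theorem sum_single_mul_mul_single_swap (A : Matrix n n R) :
    ∑ i : n, ∑ j : n, single i j (1 : R) * A * single j i 1 = A.trace • (1 : Matrix n n R) := by
  simp only [single_mul_mul_single, one_mul, mul_one]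
  rw [Finset.sum_comm]
  have h : ∀ j : n, ∑ i : n, single i i (A j j) = A j j • (1 : Matrix n n R) := fun j => by
    rw [matrix_eq_sum_single (A j j • (1 : Matrix n n R))]
    refine Finset.sum_congr rfl fun i _ => ?_
    rw [Finset.sum_eq_single i]
    · simp
    · intro b _ hb; simp [one_apply_ne' hb]
    · intro h; exact absurd (Finset.mem_univ i) h
  simp only [h]
  rw [← Finset.sum_smul]
  rfl

/-- ★ **`Σ_ij X_ij A X_ij = 2(Aᵀ − (tr A)·1)`**: the `𝔰𝔬(N)` completeness relation in sandwich form — the transpose is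
the TWISTING and the trace the SPLITTING of Chatterjee's master loop equation. [folklore] -/
theorem sum_soDir_mul_mul_soDir (A : Matrix n n R) :
    ∑ i : n, ∑ j : n, soDir i j * A * soDir i j = (2 : R) • (Aᵀ - A.trace • (1 : Matrix n n R)) := by
  have h : ∀ i j : n, (soDir i j : Matrix n n R) * A * soDir i j =
      (single i j (1 : R) * A * single i j 1 - single i j (1 : R) * A * single j i 1) -
        (single j i (1 : R) * A * single i j 1 - single j i (1 : R) * A * single j i 1) := by
    intro i j
    simp only [soDir, Matrix.sub_mul, Matrix.mul_sub]
    abel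
  simp only [h, Finset.sum_sub_distrib, sum_single_mul_mul_single_same, sum_single_mul_mul_single_swap]
  rw [Finset.sum_comm (f := fun i j => single j i (1 : R) * A * single i j 1),
    Finset.sum_comm (f := fun i j => single j i (1 : R) * A * single j i 1),
    sum_single_mul_mul_single_swap, sum_single_mul_mul_single_same, two_smul]
  abel

/-- ★ **The Casimir: `Σ_ij X_ij X_ij = −2(N−1)·1`** (`N = #n`). [folklore] -/
theorem sum_soDir_mul_soDir :
    ∑ i : n, ∑ j : n, (soDir i j : Matrix n n R) * soDir i j =
      -((2 : R) * ((Fintype.card n : R) - 1)) • (1 : Matrix n n R) := by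
  have h := sum_soDir_mul_mul_soDir (1 : Matrix n n R)
  simp only [Matrix.mul_one, transpose_one, trace_one] at h
  rw [h, smul_sub, smul_smul, ← sub_smul, neg_smul, ← neg_smul]
  congr 1
  ring

/-- ★ **`Σ_ij tr(X_ij A)·tr(X_ij B) = 2(tr(A Bᵀ) − tr(A B))`** — the MERGER (and deformation) contraction. [folklore] -/
theorem sum_trace_soDir_mul_mul_trace_soDir_mul (A B : Matrix n n R) :
    ∑ i : n, ∑ j : n, (soDir i j * A).trace * (soDir i j * B).trace = 2 * ((A * Bᵀ).trace - (A * B).trace) := by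
  have h : ∀ i j : n, ((soDir i j : Matrix n n R) * A).trace = A j i - A i j := fun i j => by
    simp only [soDir, Matrix.sub_mul, trace_sub, trace_single_mul, one_smul]
  have hB : ∀ i j : n, ((soDir i j : Matrix n n R) * B).trace = B j i - B i j := fun i j => by
    simp only [soDir, Matrix.sub_mul, trace_sub, trace_single_mul, one_smul]
  simp only [h, hB]
  have e1 : (A * Bᵀ).trace = ∑ i : n, ∑ j : n, A i j * B i j := by
    simp only [trace, diag_apply, mul_apply, transpose_apply]
  have e2 : (A * B).trace = ∑ i : n, ∑ j : n, A i j * B j i := by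
    simp only [trace, diag_apply, mul_apply]
  have e3 : ∑ i : n, ∑ j : n, A j i * B j i = ∑ i : n, ∑ j : n, A i j * B i j := Finset.sum_comm
  have e4 : ∑ i : n, ∑ j : n, A j i * B i j = ∑ i : n, ∑ j : n, A i j * B j i := Finset.sum_comm
  have expand : ∀ i j : n, (A j i - A i j) * (B j i - B i j) =
      A j i * B j i + A i j * B i j - A j i * B i j - A i j * B j i := fun i j => by ring
  simp only [expand, Finset.sum_sub_distrib, Finset.sum_add_distrib, e1, e2, e3, e4]
  ring

/-- `Σ_ij tr(X_ij A X_ij B) = 2(tr(Aᵀ B) − tr A · tr B)` (the sandwich form under a trace: `tr((Σ X A X) B)`). [folklore] -/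
theorem sum_trace_soDir_sandwich (A B : Matrix n n R) :
    ∑ i : n, ∑ j : n, (soDir i j * A * soDir i j * B).trace = 2 * ((Aᵀ * B).trace - A.trace * B.trace) := by
  have h : ∑ i : n, ∑ j : n, (soDir i j * A * soDir i j * B).trace =
      ((∑ i : n, ∑ j : n, soDir i j * A * soDir i j) * B).trace := by
    simp only [Finset.sum_mul, trace_sum]
  rw [h, sum_soDir_mul_mul_soDir, Matrix.smul_mul, trace_smul, Matrix.sub_mul, trace_sub, Matrix.smul_mul,
    Matrix.one_mul, trace_smul, smul_eq_mul, smul_eq_mul]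

/-- The Casimir under a trace: `Σ_ij tr(X_ij X_ij M) = −2(N−1) tr M`. [folklore] -/
theorem sum_trace_soDir_mul_soDir_mul (M : Matrix n n R) :
    ∑ i : n, ∑ j : n, (soDir i j * soDir i j * M).trace = -(2 * ((Fintype.card n : R) - 1)) * M.trace := by
  have h : ∑ i : n, ∑ j : n, (soDir i j * soDir i j * M).trace =
      ((∑ i : n, ∑ j : n, (soDir i j : Matrix n n R) * soDir i j) * M).trace := by
    simp only [Finset.sum_mul, trace_sum]
  rw [h, sum_soDir_mul_soDir, Matrix.smul_mul, Matrix.one_mul, trace_smul, smul_eq_mul]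

end SOMasterLoop

end Summit.QuantumFields.GaugeBoot
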